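import Mathlib.LinearAlgebra.Matrix.PosDef
import Mathlib.LinearAlgebra.Matrix.NonsingularInverse
import Literature.Analysis.ValidatedNumerics.FixedPointInterval
import HarnessLib

/-!
# Witness-free PSD test for interval matrices: congruence + diagonal dominance (interval Gershgorin)

Topic `Literature/Analysis/ValidatedNumerics`. A kernel-evaluable test that EVERY real symmetric matrix `A` enclosed entrywise by a
matrix `M` of fixed-point intervals (`Literature.Analysis.ValidatedNumerics.Numerics.FI`, scale `2^48`) is positive semidefinite, without
shipping a factorisation: the checker is handed an arbitrary integer matrix `V` (in practice: scaled approximate eigenvectors of the midpoint,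
computed by untrusted code), verifies that `V` is invertible (strict diagonal dominance of the exact integer Gram matrix `VᵀV`) and that the
interval enclosure of the congruent matrix `VᵀAV` is diagonally dominant with the enclosure's own end points. Soundness:
`psdCheck M V = true → MMem A M → Aᵀ = A → A.PosSemidef` (`posSemidef_of_psdCheck`).

The real lemmas are elementary (no spectral theory): a symmetric matrix whose diagonal dominates its off-diagonal absolute row sums has
a nonnegative form (`form_ge_diag_sub_offRowSum`: `Σ_i (A_ii − Σ_{j≠i}|A_ij|)x_i² ≤ xᵀAx`, from `2|A_ij x_i x_j| ≤ |A_ij|(x_i²+x_j²)` and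
symmetry), strictly dominant diagonal gives a positive form hence injectivity, and PSD passes through congruence by an invertible matrix.
Companion of `PSDCertificate.lean` (witness-based `LDLᵀ` certificates); both serve interval eigen-enclosure certificates of Hermitian
families (Bloch / dynamical matrices). No facts, no axioms.

## References
* R. S. Varga, *Geršgorin and His Circles*, Springer 2004, Thm. 1.1 and §1.3 (diagonal dominance). [folklore]
* S. M. Rump, *Verification of positive definiteness*, BIT 46 (2006) 433–452, §3 (verification after an approximate
  diagonalisation). [folklore]
-/

open Matrix Finset

namespace Literature.Analysis.ValidatedNumerics.IntervalGershgorin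

open Literature.Analysis.ValidatedNumerics.Numerics

/-! ### Real lemmas: diagonal dominance and congruence -/

section Real

variable {ι : Type*} [Fintype ι] [DecidableEq ι]

/-- Off-diagonal absolute row sum `Σ_{j ≠ i} |A i j|` (written with an `if` for easy algebra). [folklore] -/
def offRowSum (A : Matrix ι ι ℝ) (i : ι) : ℝ := ∑ j, if j = i then 0 else |A i j|

omit [DecidableEq ι] in
/-- `xᵀAx` as a double sum. [folklore] -/
theorem form_eq_sum_sum (A : Matrix ι ι ℝ) (x : ι → ℝ) :
    x ⬝ᵥ A *ᵥ x = ∑ i, ∑ j, A i j * (x i * x j) := by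
  simp only [dotProduct, mulVec, Finset.mul_sum]
  refine Finset.sum_congr rfl fun i _ => Finset.sum_congr rfl fun j _ => by ring

/-- **Diagonal dominance bound of a symmetric form**: `Σ_i (A_ii − Σ_{j≠i}|A_ij|)·x_i² ≤ xᵀAx`. [folklore] -/
theorem form_ge_diag_sub_offRowSum (A : Matrix ι ι ℝ) (hs : Aᵀ = A) (x : ι → ℝ) :
    ∑ i, (A i i - offRowSum A i) * x i ^ 2 ≤ x ⬝ᵥ A *ᵥ x := by
  have hsym : ∀ i j, A j i = A i j := fun i j => by
    simpa [transpose_apply] using congrFun (congrFun hs i) j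
  -- pointwise lower bound of each term of the double sum
  have hpt : ∀ i j, (if j = i then A i i * x i ^ 2 else -(|A i j| * (x i ^ 2 + x j ^ 2) / 2)) ≤ A i j * (x i * x j) := by
    intro i j
    split_ifs with h
    · subst h; nlinarith
    · have h1 : |A i j * (x i * x j)| ≤ |A i j| * (x i ^ 2 + x j ^ 2) / 2 := by
        rw [abs_mul, abs_mul]
        have : |x i| * |x j| ≤ (x i ^ 2 + x j ^ 2) / 2 := by
          nlinarith [sq_nonneg (|x i| - |x j|), sq_abs (x i), sq_abs (x j)]
        nlinarith [abs_nonneg (A i j)]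
      linarith [neg_abs_le (A i j * (x i * x j))]
  rw [form_eq_sum_sum]
  refine le_trans (le_of_eq ?_) (Finset.sum_le_sum fun i _ => Finset.sum_le_sum fun j _ => hpt i j)
  -- evaluate the double sum of the bounds
  have hB : ∀ i, ∑ j, (if j = i then A i i * x i ^ 2 else -(|A i j| * (x i ^ 2 + x j ^ 2) / 2)) =
      A i i * x i ^ 2 - (∑ j, if j = i then 0 else |A i j| * x i ^ 2 / 2) -
        ∑ j, if j = i then 0 else |A i j| * x j ^ 2 / 2 := by
    intro i
    have hfun : (fun j => if j = i then A i i * x i ^ 2 else -(|A i j| * (x i ^ 2 + x j ^ 2) / 2)) =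
        fun j => ((if j = i then A i i * x i ^ 2 else 0) - (if j = i then 0 else |A i j| * x i ^ 2 / 2)) -
          (if j = i then 0 else |A i j| * x j ^ 2 / 2) := by
      funext j; split_ifs <;> ring
    rw [hfun, Finset.sum_sub_distrib, Finset.sum_sub_distrib, Finset.sum_ite_eq' Finset.univ i]
    simp
  simp_rw [hB]
  have hswap : ∑ i, ∑ j, (if j = i then 0 else |A i j| * x j ^ 2 / 2) =
      ∑ i, ∑ j, (if j = i then 0 else |A i j| * x i ^ 2 / 2) := by
    rw [Finset.sum_comm]
    refine Finset.sum_congr rfl fun i _ => Finset.sum_congr rfl fun j _ => ?_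
    by_cases h : i = j
    · subst h; simp
    · rw [if_neg h, if_neg (Ne.symm h), hsym j i]
  rw [Finset.sum_sub_distrib, Finset.sum_sub_distrib, hswap, ← Finset.sum_sub_distrib, ← Finset.sum_sub_distrib]
  refine Finset.sum_congr rfl fun i _ => ?_
  rw [offRowSum, sub_mul, Finset.sum_mul, sub_sub, ← Finset.sum_add_distrib]
  congr 1
  refine Finset.sum_congr rfl fun j _ => ?_
  split_ifs <;> ring

/-- Diagonally dominant symmetric matrices have a nonnegative form. [folklore] -/
theorem form_nonneg_of_diagDominant {A : Matrix ι ι ℝ} (hs : Aᵀ = A) (hd : ∀ i, offRowSum A i ≤ A i i)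
    (x : ι → ℝ) : 0 ≤ x ⬝ᵥ A *ᵥ x :=
  le_trans (Finset.sum_nonneg fun i _ => mul_nonneg (sub_nonneg.2 (hd i)) (sq_nonneg _))
    (form_ge_diag_sub_offRowSum A hs x)

/-- Diagonally dominant symmetric matrices are positive semidefinite. [folklore] -/
theorem posSemidef_of_diagDominant {A : Matrix ι ι ℝ} (hs : Aᵀ = A) (hd : ∀ i, offRowSum A i ≤ A i i) :
    A.PosSemidef :=
  PosSemidef.of_dotProduct_mulVec_nonneg (by simpa [IsHermitian, conjTranspose_eq_transpose_of_trivial] using hs)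
    fun x => by simpa using form_nonneg_of_diagDominant hs hd x

/-- Strictly diagonally dominant symmetric matrices have a positive form on nonzero vectors. [folklore] -/
theorem form_pos_of_strictDiagDominant {A : Matrix ι ι ℝ} (hs : Aᵀ = A) (hd : ∀ i, offRowSum A i < A i i)
    {x : ι → ℝ} (hx : x ≠ 0) : 0 < x ⬝ᵥ A *ᵥ x := by
  obtain ⟨i0, hi0⟩ : ∃ i, x i ≠ 0 := by
    by_contra h
    push Not at h
    exact hx (funext h)
  refine lt_of_lt_of_le ?_ (form_ge_diag_sub_offRowSum A hs x)
  refine lt_of_lt_of_le ?_ (Finset.single_le_sum (f := fun i => (A i i - offRowSum A i) * x i ^ 2)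
    (fun i _ => mul_nonneg (sub_nonneg.2 (hd i).le) (sq_nonneg _)) (Finset.mem_univ i0))
  exact mul_pos (sub_pos.2 (hd i0)) (by positivity)

/-- A real square matrix whose Gram matrix `VᵀV` is strictly diagonally dominant is invertible. [folklore] -/
theorem isUnit_of_gram_strictDiagDominant {V : Matrix ι ι ℝ} (hd : ∀ i, offRowSum (Vᵀ * V) i < (Vᵀ * V) i i) :
    IsUnit V := by
  rw [← mulVec_injective_iff_isUnit]
  intro y₁ y₂ h
  by_contra hne
  have hne' : y₁ - y₂ ≠ 0 := sub_ne_zero.2 hne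
  have hpos := form_pos_of_strictDiagDominant (transpose_mul Vᵀ V ▸ by simp) hd hne'
  have hzero : V *ᵥ (y₁ - y₂) = 0 := by rw [mulVec_sub, h, sub_self]
  have : (y₁ - y₂) ⬝ᵥ (Vᵀ * V) *ᵥ (y₁ - y₂) = 0 := by
    rw [← mulVec_mulVec, dotProduct_mulVec, vecMul_transpose, hzero, dotProduct_zero]
  linarith

/-- PSD passes through congruence by an invertible matrix: `Vᵀ A V ⪰ 0 ⇒ A ⪰ 0`. [folklore] -/
theorem posSemidef_of_congr {A V : Matrix ι ι ℝ} (hs : Aᵀ = A) (hV : IsUnit V) (h : (Vᵀ * A * V).PosSemidef) :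
    A.PosSemidef := by
  refine PosSemidef.of_dotProduct_mulVec_nonneg
    (by simpa [IsHermitian, conjTranspose_eq_transpose_of_trivial] using hs) fun x => ?_
  obtain ⟨y, rfl⟩ := mulVec_surjective_iff_isUnit.2 hV x
  have key : (V *ᵥ y) ⬝ᵥ A *ᵥ (V *ᵥ y) = y ⬝ᵥ (Vᵀ * A * V) *ᵥ y := by
    rw [← mulVec_mulVec, ← mulVec_mulVec, dotProduct_mulVec y Vᵀ, vecMul_transpose]
  have h1 := h.dotProduct_mulVec_nonneg y
  rw [star_trivial] at h1 ⊢
  rw [key]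
  exact h1

end Real

/-! ### Interval matrices over `FI` and the checker -/

/-- Interval matrices with `Fin n` indices. [folklore] -/
abbrev IMat (n : ℕ) := Fin n → Fin n → FI

/-- Entrywise enclosure. [folklore] -/
def MMem {n : ℕ} (A : Matrix (Fin n) (Fin n) ℝ) (M : IMat n) : Prop := ∀ i j, FI.mem (A i j) (M i j)

/-- Interval sum of a list (left fold of `FI.add`). [folklore] -/
def lsum (l : List FI) : FI := l.foldl FI.add (FI.ofInt 0)

/-- [folklore] -/
lemma mem_foldl_add {acc : FI} {a : ℝ} (ha : FI.mem a acc) :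
    ∀ (l : List FI) (g : List ℝ), List.Forall₂ (fun x I => FI.mem x I) g l →
      FI.mem (a + g.sum) (l.foldl FI.add acc)
  | [], g, h => by cases h; simpa using ha
  | I :: l, g, h => by
    cases h with
    | cons hx hrest =>
      rename_i x g'
      have := mem_foldl_add (FI.mem_add ha hx) l g' hrest
      simpa [add_assoc] using this

/-- Membership of a finite sum in the interval sum. [folklore] -/
theorem mem_lsum_ofFn {m : ℕ} {g : Fin m → ℝ} {f : Fin m → FI} (h : ∀ i, FI.mem (g i) (f i)) :
    FI.mem (∑ i, g i) (lsum (List.ofFn f)) := by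
  have hz : FI.mem (0 : ℝ) (FI.ofInt 0) := by simpa using FI.mem_ofInt 0
  have h2 : List.Forall₂ (fun x I => FI.mem x I) (List.ofFn g) (List.ofFn f) := by
    rw [List.forall₂_iff_get]
    refine ⟨by simp, fun i h1 h2 => ?_⟩
    simpa using h ⟨i, by simpa using h1⟩
  have := mem_foldl_add hz (List.ofFn f) (List.ofFn g) h2
  simpa [lsum, List.sum_ofFn] using this

/-- Interval enclosure of the congruent matrix `VᵀAV` for an integer matrix `V`: `W a b = Σ_i Σ_j M_ij · (V_ia V_jb)`. [folklore] -/
def congr {n : ℕ} (M : IMat n) (V : Fin n → Fin n → ℤ) : IMat n := fun a b =>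
  lsum (List.ofFn fun i => lsum (List.ofFn fun j => (M i j).mulInt (V i a * V j b)))

/-- The real matrix of an integer matrix. [folklore] -/
def intMat {n : ℕ} (V : Fin n → Fin n → ℤ) : Matrix (Fin n) (Fin n) ℝ := fun i j => (V i j : ℝ)

/-- `congr` encloses `VᵀAV`. [folklore] -/
theorem mmem_congr {n : ℕ} {A : Matrix (Fin n) (Fin n) ℝ} {M : IMat n} (hA : MMem A M) (V : Fin n → Fin n → ℤ) :
    MMem ((intMat V)ᵀ * A * intMat V) (congr M V) := by
  intro a b
  have hexp : ((intMat V)ᵀ * A * intMat V) a b = ∑ i, ∑ j, A i j * ((V i a * V j b : ℤ) : ℝ) := by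
    simp only [mul_apply, transpose_apply, intMat, Finset.sum_mul, Int.cast_mul]
    rw [Finset.sum_comm]
    refine Finset.sum_congr rfl fun i _ => Finset.sum_congr rfl fun j _ => by ring
  rw [hexp]
  exact mem_lsum_ofFn fun i => mem_lsum_ofFn fun j => FI.mem_mulInt (hA i j) _

/-- Scaled off-diagonal absolute row sums of an interval matrix (upper bounds, integers). [folklore] -/
def offAbsHi {n : ℕ} (M : IMat n) (i : Fin n) : ℤ := (List.ofFn fun j => if j = i then 0 else (M i j).absHi).sum

/-- Diagonal dominance test on the enclosure: `Σ_{j≠i} absHi(M i j) ≤ lo(M i i)` for all `i`. [folklore] -/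
def ddCheck {n : ℕ} (M : IMat n) : Bool := decide (∀ i, offAbsHi M i ≤ (M i i).lo)

/-- Every real matrix in a `ddCheck`ed enclosure is diagonally dominant. [folklore] -/
theorem offRowSum_le_of_ddCheck {n : ℕ} {A : Matrix (Fin n) (Fin n) ℝ} {M : IMat n} (h : ddCheck M = true)
    (hA : MMem A M) (i : Fin n) : offRowSum A i ≤ A i i := by
  unfold ddCheck at h
  have hi := (of_decide_eq_true h) i
  have h1 : offRowSum A i * SC ≤ (offAbsHi M i : ℝ) := by
    rw [offRowSum, offAbsHi, List.sum_ofFn, Finset.sum_mul]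
    push_cast
    refine Finset.sum_le_sum fun j _ => ?_
    split_ifs
    · simp
    · exact FI.abs_le_absHi (hA i j)
  have h2 : ((M i i).lo : ℝ) ≤ A i i * SC := (hA i i).1
  have h3 : (offAbsHi M i : ℝ) ≤ (M i i).lo := by exact_mod_cast hi
  nlinarith [SC_pos]

/-- Integer Gram matrix `VᵀV`. [folklore] -/
def gram {n : ℕ} (V : Fin n → Fin n → ℤ) : Fin n → Fin n → ℤ := fun a b => (List.ofFn fun i => V i a * V i b).sum

/-- Strict diagonal dominance of an integer matrix. [folklore] -/
def sddInt {n : ℕ} (G : Fin n → Fin n → ℤ) : Bool :=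
  decide (∀ i, (List.ofFn fun j => if j = i then 0 else |G i j|).sum < G i i)

/-- [folklore] -/
theorem gram_eq {n : ℕ} (V : Fin n → Fin n → ℤ) (a b : Fin n) :
    ((intMat V)ᵀ * intMat V) a b = (gram V a b : ℝ) := by
  simp only [mul_apply, transpose_apply, intMat, gram, List.sum_ofFn]
  push_cast
  rfl

/-- `sddInt (gram V)` certifies that `V` is invertible over `ℝ`. [folklore] -/
theorem isUnit_of_sddInt_gram {n : ℕ} {V : Fin n → Fin n → ℤ} (h : sddInt (gram V) = true) : IsUnit (intMat V) := by
  unfold sddInt at h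
  have hh := of_decide_eq_true h
  refine isUnit_of_gram_strictDiagDominant fun i => ?_
  have hi := hh i
  rw [offRowSum, gram_eq]
  have : (∑ j, if j = i then (0 : ℝ) else |((intMat V)ᵀ * intMat V) i j|) =
      (((List.ofFn fun j => if j = i then 0 else |gram V i j|).sum : ℤ) : ℝ) := by
    rw [List.sum_ofFn]
    push_cast
    refine Finset.sum_congr rfl fun j _ => ?_
    split_ifs <;> simp [gram_eq]
  rw [this]
  exact_mod_cast hi

/-- **The witness-free PSD checker**: invertibility of `V` by strict dominance of `VᵀV`, then diagonal dominance of the enclosure of `VᵀAV`. [folklore] -/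
def psdCheck {n : ℕ} (M : IMat n) (V : Fin n → Fin n → ℤ) : Bool := sddInt (gram V) && ddCheck (congr M V)

/-- **Soundness of `psdCheck`**: every symmetric real matrix enclosed by `M` is positive semidefinite. [folklore] -/
theorem posSemidef_of_psdCheck {n : ℕ} {M : IMat n} {V : Fin n → Fin n → ℤ} (h : psdCheck M V = true)
    {A : Matrix (Fin n) (Fin n) ℝ} (hA : MMem A M) (hs : Aᵀ = A) : A.PosSemidef := by
  simp only [psdCheck, Bool.and_eq_true] at h
  have hV := isUnit_of_sddInt_gram h.1
  refine posSemidef_of_congr hs hV (posSemidef_of_diagDominant ?_ ?_)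
  · rw [transpose_mul, transpose_mul, transpose_transpose, hs, Matrix.mul_assoc]
  · exact offRowSum_le_of_ddCheck h.2 (mmem_congr hA V)

/-! ### A `2 × 2` smoke test evaluated by the kernel -/

/-- The enclosure of `[[2, 1], [1, 2]] ± 2⁻⁴⁸` is certified PSD with `V = [[1, 1], [-1, 1]]` (eigenvectors; `VᵀAV = diag(2, 6)`). [folklore] -/
example : psdCheck (n := 2) (fun i j => if i = j then ⟨2 * SC - 1, 2 * SC + 1⟩ else ⟨SC - 1, SC + 1⟩)
    (fun i j => if i = 0 then 1 else if j = 0 then -1 else 1) = true := by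
  decide +kernel

end Literature.Analysis.ValidatedNumerics.IntervalGershgorin
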